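import Literature.Probability.Percolation.TriRhombusDomain
import Literature.Probability.Percolation.MarkedLoopHolomorphicDefect
import HarnessLib

/-!
# The seven corner faces of the marked rhombus `rhombus24SevenB`, and its bond universe

Topic `Literature/Probability/Percolation`; family `crit-perc`. Bookkeeping for the kernel census of cores on the seven-marked 2 × 4 rhombus
(`TriRhombusDomain.lean`, marking B: marks at the sites `(−1,−1), (0,−1), (0,0), (0,1), (0,2), (−1,1), (−1,0)`): the CORNER FACES `y_0, …, y_6`
(Khristoforov–Smirnov's boundary disorders; Bollobás–Riordan's marked points seen from the outer face) tabulated and identified with the tree's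
`yc rhombus24SevenB` (`yc_rhombus24SevenB`), and the explicit finite universe `rhombus24Bonds` of the bonds of `H_G` (the six bonds at each of
the eight sites), through which `E⁻(v)` of every face becomes an explicit finset (`eminus_rhombus24SevenB_subset`). No mathematics beyond
finite checks; used by the three face censuses `MarkedLoopRhombusCensusOne/Two/Three.lean`.

## References
* B. Bollobás, O. Riordan, *Percolation*, Cambridge University Press (2006), Ch. 7 §7.2.2, pp. 192–193 (marked discrete domains).
* M. Khristoforov, S. Smirnov, *Percolation and O(1) loop model*, arXiv:2111.15612 (2021), §1.2 (arXiv v1 pp. 2–3), §2 Lemma 4 (p. 4).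

## Mathlib / tree
Tree: `TriRhombusDomain.lean` (`rhombus24SevenB`), `MarkedLoopSpace.lean` (`IsCornerFace`, `yc`, `isCornerFace_iff_eq_yc`, `corners`), `MarkedLoopCoreCensus.lean`
is NOT imported (this file is below it in the import order of the censuses). Mathlib: `decide`.
-/

open Finset

namespace Literature.Probability.Percolation.MarkedLoops

open Literature.Probability.Percolation Literature.Probability.LatticeModels
open Literature.Probability.Percolation.FivePoint (xiDeg XiLinked side tau)
open TriMarkedDomain

set_option maxRecDepth 400000

/-- the corner faces `y_0, …, y_6` of `rhombus24SevenB`, tabulated: the outer faces at the marked sites `(−1,−1), (0,−1), (0,0), (0,1), (0,2),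
(−1,1), (−1,0)` spanned by the two outer neighbours preceding the mark dart. [cite: BollobasRiordan2006, Ch. 7 §7.2.2 pp. 192–193] -/
def rhombusCornerB : Fin 7 → HexVertex := ![(![-2, -1], 0), (![0, -2], 0), (![0, -1], 1), (![0, 0], 1), (![0, 1], 1), (![-2, 1], 0), (![-2, 0], 0)]

/-- the tabulated faces ARE the corner faces. [cite: BollobasRiordan2006, Ch. 7 §7.2.2 pp. 192–193] -/
theorem isCornerFace_rhombusCornerB (j : Fin 7) : IsCornerFace rhombus24SevenB j (rhombusCornerB j) := by
  revert j
  unfold IsCornerFace predDart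
  decide

/-- `yc rhombus24SevenB = rhombusCornerB`. [cite: BollobasRiordan2006, Ch. 7 §7.2.2 pp. 192–193] -/
theorem yc_rhombus24SevenB (j : Fin 7) : yc rhombus24SevenB j = rhombusCornerB j :=
  ((isCornerFace_iff_eq_yc rhombus24SevenB).1 (isCornerFace_rhombusCornerB j)).symm

/-- the corner set of `rhombus24SevenB`, tabulated. [cite: BollobasRiordan2006, Ch. 7 §7.2.2 pp. 192–193] -/
theorem corners_rhombus24SevenB : corners rhombus24SevenB = (Finset.univ : Finset (Fin 7)).image rhombusCornerB := by
  unfold corners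
  exact Finset.image_congr fun j _ => yc_rhombus24SevenB j

/-- **the bond universe of the rhombus**: the six bonds of `𝕋` at each site of `rhombus24` (a computable finset containing `hBonds`).
[cite: KhristoforovSmirnov2021, §1.2 (arXiv v1 pp. 2–3: the edges of `Ω`)] -/
def rhombus24Bonds : Finset (Sym2 (Site 2)) := rhombus24.biUnion fun u => (Finset.univ : Finset (Fin 6)).image fun j => s(u, u + triDir j)

/-- every bond at a site of the rhombus is in the universe. [cite: KhristoforovSmirnov2021, §1.2 (arXiv v1 pp. 2–3)] -/
theorem mem_rhombus24Bonds : ∀ u ∈ rhombus24SevenB.verts, ∀ j : Fin 6, s(u, u + triDir j) ∈ rhombus24Bonds := by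
  intro u hu j
  unfold rhombus24Bonds
  exact Finset.mem_biUnion.2 ⟨u, hu, Finset.mem_image.2 ⟨j, Finset.mem_univ _, rfl⟩⟩

end Literature.Probability.Percolation.MarkedLoops
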